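import Summits.QuantumAdvantage.AdviceFreeQNC0.NPGamma37
import HarnessLib

/-!
# Cell qa-qnc0 — the FAN-IN LAW from `RingHardFewCouplings3` (planner qa-qnc0-p2 g34, ROUND-34P2 §4.6, INBOX P2-34e)

`RingHardFanIn3`: every classical strategy for the `p = 3` ring relation whose `i`-th output is an ARBITRARY Boolean
function of a set `R i` of inputs with `(Σ_i |R i|²)·C·(log₂ n)³ ≤ n²` (in particular: every output of fan-in
`≤ √n / (√C (log₂ n)^{3/2})`; no locality, no geometry, no degree) wins on at most `(1 − n^{-e})·2^{n−1}` odd inputs.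
`ringHardFanIn3_of_few : RingHardFewCouplings3 → RingHardFanIn3` (same `e, C, n₀`), via the junta representation
lemma `mem_span_of_dependsOn` (a function of `x|_R` is an `F`-combination of the monomials `x_S`, `S ⊆ R`) and the
count `card_cpairs_le` (pairs coupled by `⋃_i 𝒫(R i)` number `≤ Σ_i |R i|²`).  With `NPGamma37Proof.ringHardFewCouplings3`
(land2/NPGamma37Sparse) this is unconditional with `e = 6`, `C = 2^21`, `n₀ = 4096`.  A RUNG (poly loss), not the θ < 1 crux.
-/

namespace Summit.QuantumAdvantage.AdviceFreeQNC0.NPGamma37FanIn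

open Finset Classical Literature.Computability.QuantumComplexity Literature.Computability.MetaComplexity
open Summit.QuantumAdvantage.AdviceFreeQNC0.NPGamma37 (NCoupled RingHardFewCouplings3)

variable {n : ℕ}

section Junta

variable {F : Type*} [Field F]

/-- relative point indicator on the coordinates `R`: `[x|_R = 1_A] = Σ_{T ⊆ R∖A} (−1)^{|T|} x_{A ∪ T}`. -/
theorem indicatorOn_eq_sum (R A : Finset (Fin n)) (hA : A ⊆ R) :
    (fun b : Fin n → Bool => if (∀ i ∈ R, b i = decide (i ∈ A)) then (1 : F) else 0) =
      ∑ T ∈ (R \ A).powerset, ((-1 : F) ^ T.card) • Smolensky.mono F (A ∪ T) := by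
  funext b
  simp only [Finset.sum_apply, Pi.smul_apply, smul_eq_mul]
  have hR : ∑ T ∈ (R \ A).powerset, (-1 : F) ^ T.card * Smolensky.mono F (A ∪ T) b =
      Smolensky.mono F A b * ∏ i ∈ R \ A, (1 + -(if b i then (1 : F) else 0)) := by
    rw [Finset.prod_one_add, Finset.mul_sum]
    refine Finset.sum_congr rfl fun T _ => ?_
    rw [Finset.prod_neg, ← Smolensky.mono_mul, Pi.mul_apply]
    simp only [Smolensky.mono]
    ring
  rw [hR]
  by_cases hb : ∀ i ∈ R, b i = decide (i ∈ A)
  · rw [if_pos hb]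
    have h1 : Smolensky.mono F A b = 1 := by
      rw [Smolensky.mono_apply, if_pos]
      intro i hi
      have := hb i (hA hi)
      simpa [hi] using this
    have h2 : ∏ i ∈ R \ A, (1 + -(if b i then (1 : F) else 0)) = 1 := by
      refine Finset.prod_eq_one fun i hi => ?_
      rw [Finset.mem_sdiff] at hi
      have := hb i hi.1
      simp only [hi.2, decide_false] at this
      simp [this]
    rw [h1, h2, mul_one]
  · rw [if_neg hb]
    have : ∃ i, i ∈ R ∧ b i ≠ decide (i ∈ A) := by
      by_contra hcon
      apply hb
      intro i hi
      by_contra hne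
      exact hcon ⟨i, hi, hne⟩
    obtain ⟨i, hiR, hne⟩ := this
    by_cases hiA : i ∈ A
    · have hbi : b i = false := by simpa [hiA] using hne
      have h0 : Smolensky.mono F A b = 0 := by
        rw [Smolensky.mono_apply, if_neg]
        intro h
        have := h i hiA
        simp [hbi] at this
      rw [h0, zero_mul]
    · have hbi : b i = true := by simpa [hiA] using hne
      have hmem : i ∈ R \ A := Finset.mem_sdiff.2 ⟨hiR, hiA⟩
      rw [Finset.prod_eq_zero hmem (by simp [hbi]), mul_zero]

/-- **Junta representation**: a function on the cube depending only on the coordinates in `R` is an `F`-combination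
of the monomials `x_S`, `S ⊆ R`. -/
theorem mem_span_of_dependsOn (R : Finset (Fin n)) (g : Smolensky.CubeFn F n)
    (hg : ∀ x y : Fin n → Bool, (∀ j ∈ R, x j = y j) → g x = g y) :
    g ∈ Submodule.span F (Smolensky.mono F '' {S : Finset (Fin n) | S ⊆ R}) := by
  have hg' : g = ∑ A ∈ R.powerset, g (fun i => decide (i ∈ A)) •
      (fun b : Fin n → Bool => if (∀ i ∈ R, b i = decide (i ∈ A)) then (1 : F) else 0) := by
    funext b
    simp only [Finset.sum_apply, Pi.smul_apply, smul_eq_mul]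
    rw [Finset.sum_eq_single (R.filter fun i => b i = true)]
    · have h1 : ∀ i ∈ R, b i = decide (i ∈ R.filter fun i => b i = true) := by
        intro i hi
        cases hbi : b i <;> simp [Finset.mem_filter, hi, hbi]
      rw [if_pos h1, mul_one]
      exact hg _ _ h1
    · intro A hA hne
      rw [if_neg, mul_zero]
      intro hall
      apply hne
      ext i
      simp only [Finset.mem_filter]
      constructor
      · intro hi
        have hiR : i ∈ R := Finset.mem_powerset.1 hA hi
        have := hall i hiR
        simp only [hi, decide_true] at this
        exact ⟨hiR, this⟩
      · rintro ⟨hiR, hbi⟩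
        have := hall i hiR
        rw [hbi] at this
        simpa using this
    · intro hnot
      exact absurd (Finset.mem_powerset.2 (Finset.filter_subset _ _)) hnot
  rw [hg']
  refine Submodule.sum_mem _ fun A hA => Submodule.smul_mem _ _ ?_
  rw [indicatorOn_eq_sum R A (Finset.mem_powerset.1 hA)]
  refine Submodule.sum_mem _ fun T hT => Submodule.smul_mem _ _ (Submodule.subset_span ⟨A ∪ T, ?_, rfl⟩)
  have hT' : T ⊆ R \ A := Finset.mem_powerset.1 hT
  show A ∪ T ⊆ R
  exact Finset.union_subset (Finset.mem_powerset.1 hA) (hT'.trans Finset.sdiff_subset)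

end Junta

/-- **FAN-IN LAW** (statement): outputs = arbitrary functions of input sets `R i` with `(Σ_i |R i|²)·C·(log₂ n)³ ≤ n²`
⇒ odd-class wins `≤ (1 − n^{-e})·2^{n−1}`. -/
def RingHardFanIn3 : Prop :=
  ∃ e C n₀ : ℕ, ∀ n ≥ n₀, ∀ R : Fin n → Finset (Fin n),
    (∑ i, (R i).card ^ 2) * (C * Nat.log 2 n ^ 3) ≤ n ^ 2 →
    ∀ f : Fin n → (Fin n → Bool) → Bool,
      (∀ i, ∀ x y : Fin n → Bool, (∀ j ∈ R i, x j = y j) → f i x = f i y) →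
      ((univ.filter fun x : Fin n → Bool => OddZeros x ∧ RingHLF.Rel x (fun i => f i x)).card : ℝ) ≤
        (1 - 1 / (n : ℝ) ^ e) * (2 : ℝ) ^ (n - 1)

/-- pairs coupled by the support family `⋃_i 𝒫(R i)` number at most `Σ_i |R i|²`. -/
theorem card_cpairs_le (R : Fin n → Finset (Fin n)) :
    ((univ : Finset (Fin n × Fin n)).filter fun ab => ab.1 < ab.2 ∧
        NCoupled (↑(univ.biUnion fun i => (R i).powerset) : Set (Finset (Fin n))) ab.1 ab.2).card ≤
      ∑ i, (R i).card ^ 2 := by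
  calc _ ≤ (univ.biUnion fun i => R i ×ˢ R i).card := by
        refine card_le_card fun ab hab => ?_
        simp only [mem_filter, mem_univ, true_and] at hab
        obtain ⟨_, S, hS, a, ha, b, hb, ha', hb'⟩ := hab
        rw [Finset.mem_coe, Finset.mem_biUnion] at hS
        obtain ⟨i, _, hSi⟩ := hS
        rw [Finset.mem_powerset] at hSi
        rw [Finset.mem_biUnion]
        refine ⟨i, mem_univ _, ?_⟩
        rw [Finset.mem_product]
        exact ⟨(Fin.ext ha') ▸ hSi ha, (Fin.ext hb') ▸ hSi hb⟩
    _ ≤ ∑ i, (R i ×ˢ R i).card := card_biUnion_le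
    _ = ∑ i, (R i).card ^ 2 := by simp [card_product, sq]

/-- **FAN-IN LAW from `RingHardFewCouplings3`** (same constants). -/
theorem ringHardFanIn3_of_few (h : RingHardFewCouplings3) : RingHardFanIn3 := by
  obtain ⟨e, C, n₀, h⟩ := h
  refine ⟨e, C, n₀, fun n hn R hR f hf => ?_⟩
  set 𝓢 : Finset (Finset (Fin n)) := univ.biUnion fun i => (R i).powerset with h𝓢
  set P : Fin n → Smolensky.CubeFn (ZMod 3) n := fun i x => if f i x then 1 else 0 with hPdef
  have hP : ∀ x i, decide (P i x = 1) = f i x := by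
    intro x i
    cases hfx : f i x
    · have h0 : P i x = 0 := by simp [hPdef, hfx]
      rw [h0]; decide
    · have h1 : P i x = 1 := by simp [hPdef, hfx]
      rw [h1]; decide
  have hspan : ∀ i, P i ∈ Submodule.span (ZMod 3) (Smolensky.mono (ZMod 3) '' (↑𝓢 : Set (Finset (Fin n)))) := by
    intro i
    refine Submodule.span_mono (Set.image_mono ?_) (mem_span_of_dependsOn (R i) (P i) ?_)
    · intro S hS
      rw [Set.mem_setOf_eq] at hS
      rw [Finset.mem_coe, h𝓢, Finset.mem_biUnion]
      exact ⟨i, mem_univ _, Finset.mem_powerset.2 hS⟩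
    · intro x y hxy
      simp only [hPdef, hf i x y hxy]
  have hm : ((univ : Finset (Fin n × Fin n)).filter fun ab => ab.1 < ab.2 ∧
      NCoupled (↑𝓢 : Set (Finset (Fin n))) ab.1 ab.2).card * (C * Nat.log 2 n ^ 3) ≤ n ^ 2 :=
    le_trans (Nat.mul_le_mul_right _ (by rw [h𝓢]; exact card_cpairs_le R)) hR
  have key := h n hn 𝓢 hm P hspan
  have hfilt : (univ.filter fun x : Fin n → Bool => OddZeros x ∧ RingHLF.Rel x (fun i => f i x)) =
      (univ.filter fun x : Fin n → Bool => OddZeros x ∧ RingHLF.Rel x (fun i => decide (P i x = 1))) := by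
    refine Finset.filter_congr fun x _ => ?_
    have : (fun i => decide (P i x = 1)) = fun i => f i x := funext fun i => hP x i
    rw [this]
  rw [hfilt]
  exact key

end Summit.QuantumAdvantage.AdviceFreeQNC0.NPGamma37FanIn
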